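import Literature.Geometry.Kaehler.ComplexTorusAnalyticMovingLemma
import Literature.Geometry.Kaehler.ComplexTorusAnalyticCycleClassProduct
import Literature.Geometry.Kaehler.ComplexTorusPointCycleClass
import Literature.Geometry.Kaehler.ComplexTorusAverage
import HarnessLib

/-!
# A general translate misses a subvariety of excess codimension: the moving lemma in negative
# expected dimension

Layer `Literature/Geometry/Kaehler`; lane `lit-hodgefound`, seat p07 (programme «INTERSECTION NUMBERS ARE
POINT COUNTS», file 28). Let `X = E/Λ` be a compact complex torus of dimension `g` and `Y₁, Y₂ ⊆ X` closed
analytic subsets of pure dimensions `d₁, d₂` with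

  `d₁ + d₂ < g`   (NEGATIVE expected dimension `d₁ + d₂ − g` of `Y₁ ∩ (t + Y₂)`).

The tree's moving lemma `ComplexTorusAnalyticMovingLemma.ae_inter_translate_eq_empty_or_hasPureDim`
[Fulton1998, §11.4, Example 11.4.5, Appendix B.9.2; Kleiman1974Transversality, Thm. 2] treats expected
dimension `q ≥ 0` (`d₁ + d₂ = q + g`). This file supplies the complementary case: A GENERAL TRANSLATE
`t + Y₂` IS DISJOINT FROM `Y₁`.

* §1 The incidence set `Y₁ − Y₂ = {t | Y₁ ∩ (t + Y₂) ≠ ∅}` (`sub_eq_setOf_inter_vadd_nonempty`) is compact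
  (`isCompact_sub`).
* §2 **`hausdorffMeasure_preimage_cover_sub_eq_zero`**: `𝓗^{2g}(π⁻¹(Y₁ − Y₂)) = 0` in the universal cover
  `E`. Printed proof ("dimension count", [Fulton1998, Appendix B.9.2; Chirka1989, §3.7 Cor. and §3.8]):
  `π⁻¹(Y₁ − Y₂)` is the image of the lift `π⁻¹(Y₁ × Y₂) ⊆ E ⊞ E` — an analytic subset of pure dimension
  `d₁ + d₂ < g` (`hasPureDim_preimage_prodHomeomorphL2_prod`, `hasPureDim_liftSet`), hence `𝓗^{2g}`-null
  [Chirka1989, §3.7 Cor., p. 39] (`IsAnalyticSet.hausdorffMeasure_image_eq_zero`) — under the LIPSCHITZ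
  linear map `(a, b) ↦ a − b`, which does not increase `𝓗^{2g}`-null sets
  (`LipschitzWith.hausdorffMeasure_image_le`).
* §3 **`volume_sub_eq_zero`**: `Y₁ − Y₂` is Haar-null on `X` (`ae_volume_of_ae_cover`); hence
  **`ae_inter_vadd_eq_empty`**: for Haar-a.e. `t`, `Y₁ ∩ (t + Y₂) = ∅`; the translates missing `Y₁` form an
  OPEN DENSE subset of FULL MEASURE (`isOpen_dense_ae_setOf_inter_vadd_eq_empty`), `Y₁ − Y₂ ≠ X` has empty
  interior; the `(· + t)⁻¹' Y₂ = Y₂ − t` spelling (`ae_inter_preimage_add_eq_empty`); and the case of a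
  point: a general translate of `Y` (`dim Y < g`) avoids any given point and any given finite set
  (`ae_notMem_vadd`, `ae_disjoint_vadd_of_finite`).

## References

* [Fulton1998] W. Fulton, *Intersection Theory*, 2nd ed., Springer 1998, §11.4, Example 11.4.5 and
  Appendix B.9.2 ("if `dim V + dim W < dim G/H`… a general translate `gW` is disjoint from `V`").
* [Kleiman1974Transversality] S. L. Kleiman, *The transversality of a general translate*, Compositio Math.
  28 (1974) 287–297, Thm. 2 (i).
* [Chirka1989] E. M. Chirka, *Complex Analytic Sets*, Kluwer 1989, §3.7 Cor. (p. 39), §3.8 (p. 43).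
* [BombieriGubler2001] E. Bombieri, W. Gubler, *Heights in Diophantine Geometry*, Appendix C Cor. C.1.2.
-/

open scoped Manifold Topology Pointwise ENNReal
open MeasureTheory Set Function Filter Module TopologicalSpace WithLp

namespace Literature.Geometry.Kaehler
namespace ComplexTorus

universe u

variable {ι : Type*} [Fintype ι] {E : Type u} [NormedAddCommGroup E] [InnerProductSpace ℂ E]
  [FiniteDimensional ℂ E] [MeasurableSpace E] [BorelSpace E] (Φ : (ι → ℝ) ≃L[ℝ] E)

/-! ### §1 The incidence set `Y₁ − Y₂` -/

omit [Fintype ι] [FiniteDimensional ℂ E] [MeasurableSpace E] [BorelSpace E] in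
/-- `t ∈ Y₁ − Y₂ ⟺ Y₁ ∩ (t + Y₂) ≠ ∅`. [cite: Fulton1998, Example 11.4.5] -/
theorem mem_sub_iff_inter_vadd_nonempty' (Y₁ Y₂ : Set (ComplexTorus Φ)) (t : ComplexTorus Φ) :
    t ∈ Y₁ - Y₂ ↔ (Y₁ ∩ (t +ᵥ Y₂)).Nonempty := by
  rw [Set.mem_sub]
  constructor
  · rintro ⟨x, hx, y, hy, rfl⟩
    exact ⟨x, hx, Set.mem_vadd_set.2 ⟨y, hy, by rw [vadd_eq_add, sub_add_cancel]⟩⟩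
  · rintro ⟨x, hx, hx'⟩
    obtain ⟨y, hy, rfl⟩ := Set.mem_vadd_set.1 hx'
    exact ⟨t +ᵥ y, hx, y, hy, by rw [vadd_eq_add, add_sub_cancel_right]⟩

omit [Fintype ι] [FiniteDimensional ℂ E] [MeasurableSpace E] [BorelSpace E] in
/-- **`Y₁ − Y₂` is the set of translates `t` for which `t + Y₂` meets `Y₁`.** [cite: Fulton1998, Example 11.4.5] -/
theorem sub_eq_setOf_inter_vadd_nonempty (Y₁ Y₂ : Set (ComplexTorus Φ)) :
    Y₁ - Y₂ = {t : ComplexTorus Φ | (Y₁ ∩ (t +ᵥ Y₂)).Nonempty} :=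
  Set.ext fun t ↦ mem_sub_iff_inter_vadd_nonempty' Φ Y₁ Y₂ t

omit [Fintype ι] [FiniteDimensional ℂ E] [MeasurableSpace E] [BorelSpace E] in
/-- Its complement is the set of translates missing `Y₁`: `(Y₁ − Y₂)ᶜ = {t | Y₁ ∩ (t + Y₂) = ∅}`.
[cite: Fulton1998, Example 11.4.5] -/
theorem compl_sub_eq_setOf_inter_vadd_eq_empty (Y₁ Y₂ : Set (ComplexTorus Φ)) :
    (Y₁ - Y₂)ᶜ = {t : ComplexTorus Φ | Y₁ ∩ (t +ᵥ Y₂) = ∅} := by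
  rw [sub_eq_setOf_inter_vadd_nonempty, compl_setOf]
  simp only [not_nonempty_iff_eq_empty]

omit [Fintype ι] [FiniteDimensional ℂ E] [MeasurableSpace E] [BorelSpace E] in
/-- **`Y₁ − Y₂` is compact** for closed `Y₁, Y₂` (`X` is compact). [cite: Fulton1998, §11.1 Cor. 11.1] -/
theorem isCompact_sub {Y₁ Y₂ : Set (ComplexTorus Φ)} (h₁ : IsClosed Y₁) (h₂ : IsClosed Y₂) :
    IsCompact (Y₁ - Y₂) := by
  rw [← Set.sub_image_prod]
  exact (h₁.isCompact.prod h₂.isCompact).image continuous_sub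

omit [Fintype ι] [FiniteDimensional ℂ E] [MeasurableSpace E] [BorelSpace E] in
/-- **The translates missing a closed `Y₁` form an open set.** [cite: Fulton1998, §11.1 Cor. 11.1] -/
theorem isOpen_setOf_inter_vadd_eq_empty {Y₁ Y₂ : Set (ComplexTorus Φ)} (h₁ : IsClosed Y₁) (h₂ : IsClosed Y₂) :
    IsOpen {t : ComplexTorus Φ | Y₁ ∩ (t +ᵥ Y₂) = ∅} := by
  rw [← compl_sub_eq_setOf_inter_vadd_eq_empty]
  exact (isCompact_sub Φ h₁ h₂).isClosed.isOpen_compl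

/-! ### §2 `𝓗^{2g}(π⁻¹(Y₁ − Y₂)) = 0` when `dim Y₁ + dim Y₂ < g` -/

omit [FiniteDimensional ℂ E] [MeasurableSpace E] [BorelSpace E] in
/-- **The lift of `Y₁ − Y₂` is the image of the lift of `Y₁ × Y₂` under subtraction**:
`π⁻¹(Y₁ − Y₂) = δ(π⁻¹(Y₁ × Y₂))`, `δ(a, b) = a − b` on `E ⊞ E`. [cite: Fulton1998, Example 11.4.5] -/
theorem image_sub_preimage_cover_prod (Y₁ Y₂ : Set (ComplexTorus Φ)) :
    (fun z : WithLp 2 (E × E) ↦ (ofLp z).1 - (ofLp z).2) ''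
        (cover (prodPeriodL2 Φ Φ) ⁻¹' (prodHomeomorphL2 Φ Φ ⁻¹' (Y₁ ×ˢ Y₂))) =
      cover Φ ⁻¹' (Y₁ - Y₂) := by
  ext e
  simp only [mem_image, mem_preimage, prodHomeomorphL2_cover]
  constructor
  · rintro ⟨z, ⟨h1, h2⟩, rfl⟩
    rw [cover_sub]
    exact Set.sub_mem_sub h1 h2
  · intro he
    obtain ⟨y₁, hy₁, y₂, hy₂, hye⟩ := Set.mem_sub.1 he
    obtain ⟨b, rfl⟩ := cover_surjective Φ y₂
    refine ⟨toLp 2 (e + b, b), ⟨?_, ?_⟩, ?_⟩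
    · show cover Φ (e + b) ∈ Y₁
      rwa [cover_add, ← hye, sub_add_cancel]
    · exact hy₂
    · show e + b - b = e
      rw [add_sub_cancel_right]

omit [Fintype ι] [FiniteDimensional ℂ E] [MeasurableSpace E] [BorelSpace E] in
/-- Subtraction `δ(a, b) = a − b` on `E ⊞ E` is Lipschitz (a continuous linear map). [folklore] -/
private theorem lipschitzWith_sub_withLp :
    ∃ K, LipschitzWith K (fun z : WithLp 2 (E × E) ↦ (ofLp z).1 - (ofLp z).2) := by
  set T : WithLp 2 (E × E) →L[ℝ] E :=
    (ContinuousLinearMap.fst ℝ E E - ContinuousLinearMap.snd ℝ E E).comp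
      (WithLp.prodContinuousLinearEquiv 2 ℝ E E : WithLp 2 (E × E) →L[ℝ] E × E) with hT
  refine ⟨‖T‖₊, ?_⟩
  have h : (fun z : WithLp 2 (E × E) ↦ (ofLp z).1 - (ofLp z).2) = T := by
    funext z
    rfl
  rw [h]
  exact T.lipschitz

/-- **`𝓗^{2g}(π⁻¹(Y₁ − Y₂)) = 0` when `dim Y₁ + dim Y₂ < g`** (dimension count in the universal cover:
`π⁻¹(Y₁ × Y₂)` is analytic of pure dimension `d₁ + d₂ < g`, hence `𝓗^{2g}`-null, and so is its Lipschitz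
image `π⁻¹(Y₁ − Y₂)`). [cite: Chirka1989, §3.7 Cor., p. 39] [cite: Fulton1998, Appendix B.9.2] -/
theorem hausdorffMeasure_preimage_cover_sub_eq_zero {Y₁ Y₂ : Set (ComplexTorus Φ)} {d₁ d₂ : ℕ}
    (hY₁ : HasPureDim 𝓘(ℂ, E) Y₁ d₁) (hY₂ : HasPureDim 𝓘(ℂ, E) Y₂ d₂) (hlt : d₁ + d₂ < finrank ℂ E) :
    (μH[((2 * finrank ℂ E : ℕ) : ℝ)] : Measure E) (cover Φ ⁻¹' (Y₁ - Y₂)) = 0 := by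
  -- the lift of `Y₁ × Y₂` to `E ⊞ E`
  obtain ⟨c, hcd, hLa, -, hLreg⟩ :=
    hasPureDim_liftSet (prodPeriodL2 Φ Φ) (hasPureDim_preimage_prodHomeomorphL2_prod Φ Φ hY₁ hY₂)
  have hcod : ∀ y c', y ∈ liftSet (prodPeriodL2 Φ Φ) (prodHomeomorphL2 Φ Φ ⁻¹' (Y₁ ×ˢ Y₂)) →
      IsRegularPointOfCodim 𝓘(ℂ, WithLp 2 (E × E))
        (liftSet (prodPeriodL2 Φ Φ) (prodHomeomorphL2 Φ Φ ⁻¹' (Y₁ ×ˢ Y₂))) c' y →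
      finrank ℂ (WithLp 2 (E × E)) ≤ c' + (d₁ + d₂) := by
    intro y c' hy hc'
    have h := (hLreg y ⟨hy, c', hc'⟩).codim_unique hy hc'
    omega
  have hnull : (μH[((2 * finrank ℂ E : ℕ) : ℝ)] : Measure (WithLp 2 (E × E)))
      (cover (prodPeriodL2 Φ Φ) ⁻¹' (prodHomeomorphL2 Φ Φ ⁻¹' (Y₁ ×ˢ Y₂))) = 0 := by
    have h := hLa.hausdorffMeasure_image_eq_zero hcod (p := finrank ℂ E) hlt
    rwa [image_val_liftSet] at h
  -- Lipschitz image
  obtain ⟨K, hK⟩ := lipschitzWith_sub_withLp (E := E)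
  have hle := hK.hausdorffMeasure_image_le (d := ((2 * finrank ℂ E : ℕ) : ℝ)) (by positivity)
    (cover (prodPeriodL2 Φ Φ) ⁻¹' (prodHomeomorphL2 Φ Φ ⁻¹' (Y₁ ×ˢ Y₂)))
  rw [image_sub_preimage_cover_prod, hnull, mul_zero] at hle
  exact le_antisymm hle bot_le

/-- The same for the Euclidean-normalised Hausdorff measure `𝓗ᴱ^{2g}` (Lebesgue measure of `E`).
[cite: Chirka1989, §3.7 Cor., p. 39] -/
theorem euclideanHausdorffMeasure_preimage_cover_sub_eq_zero {Y₁ Y₂ : Set (ComplexTorus Φ)} {d₁ d₂ : ℕ}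
    (hY₁ : HasPureDim 𝓘(ℂ, E) Y₁ d₁) (hY₂ : HasPureDim 𝓘(ℂ, E) Y₂ d₂) (hlt : d₁ + d₂ < finrank ℂ E) :
    (μHE[2 * finrank ℂ E] : Measure E) (cover Φ ⁻¹' (Y₁ - Y₂)) = 0 := by
  rw [Measure.euclideanHausdorffMeasure_def, Measure.smul_apply,
    hausdorffMeasure_preimage_cover_sub_eq_zero Φ hY₁ hY₂ hlt, smul_zero]

/-! ### §3 A general translate of `Y₂` misses `Y₁` -/

omit [Fintype ι] in
/-- The Euclidean Hausdorff measure `𝓗^{2 dim_ℂ E}` of `E` is a Haar (Lebesgue) measure. [folklore] -/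
private theorem isAddHaarMeasure_euclideanHausdorffMeasure :
    (μHE[2 * finrank ℂ E] : Measure E).IsAddHaarMeasure := by
  letI : InnerProductSpace ℝ E := InnerProductSpace.complexToReal
  haveI : FiniteDimensional ℝ E := FiniteDimensional.complexToReal E
  have hV : finrank ℝ E = 2 * finrank ℂ E := by rw [finrank_real_of_complex]
  rw [← hV, InnerProductSpace.euclideanHausdorffMeasure_eq_volume]; infer_instance

/-- **`Y₁ − Y₂` IS HAAR-NULL when `dim Y₁ + dim Y₂ < g`.** [cite: Fulton1998, Example 11.4.5 and Appendix B.9.2]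
[cite: Kleiman1974Transversality, Thm. 2 (i)] [cite: BombieriGubler2001, Appendix C Cor. C.1.2] -/
theorem volume_sub_eq_zero {Y₁ Y₂ : Set (ComplexTorus Φ)} {d₁ d₂ : ℕ} (hY₁ : HasPureDim 𝓘(ℂ, E) Y₁ d₁)
    (hY₂ : HasPureDim 𝓘(ℂ, E) Y₂ d₂) (hlt : d₁ + d₂ < finrank ℂ E) :
    (volume : Measure (ComplexTorus Φ)) (Y₁ - Y₂) = 0 := by
  haveI := isAddHaarMeasure_euclideanHausdorffMeasure (E := E)
  have hae : ∀ᵐ t ∂(μHE[2 * finrank ℂ E] : Measure E), cover Φ t ∉ Y₁ - Y₂ := by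
    rw [ae_iff]
    simp only [not_not]
    exact euclideanHausdorffMeasure_preimage_cover_sub_eq_zero Φ hY₁ hY₂ hlt
  have h := ae_volume_of_ae_cover Φ (p := fun x ↦ x ∉ Y₁ - Y₂) hae
  rwa [← measure_eq_zero_iff_ae_notMem] at h

/-- **A GENERAL TRANSLATE MISSES A SUBVARIETY OF EXCESS CODIMENSION**: for `Y₁, Y₂ ⊆ X` of pure dimensions
`d₁ + d₂ < g`, Haar-almost every translate `t + Y₂` is disjoint from `Y₁`.
[cite: Fulton1998, Example 11.4.5 and Appendix B.9.2] [cite: Kleiman1974Transversality, Thm. 2 (i)] -/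
theorem ae_inter_vadd_eq_empty {Y₁ Y₂ : Set (ComplexTorus Φ)} {d₁ d₂ : ℕ} (hY₁ : HasPureDim 𝓘(ℂ, E) Y₁ d₁)
    (hY₂ : HasPureDim 𝓘(ℂ, E) Y₂ d₂) (hlt : d₁ + d₂ < finrank ℂ E) :
    ∀ᵐ t ∂(volume : Measure (ComplexTorus Φ)), Y₁ ∩ (t +ᵥ Y₂) = ∅ := by
  have h := (measure_eq_zero_iff_ae_notMem (μ := (volume : Measure (ComplexTorus Φ)))).1
    (volume_sub_eq_zero Φ hY₁ hY₂ hlt)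
  filter_upwards [h] with t ht
  rwa [mem_sub_iff_inter_vadd_nonempty', not_nonempty_iff_eq_empty] at ht

/-- **The translates missing `Y₁` form an open dense subset of full measure.**
[cite: Fulton1998, Example 11.4.5 and Appendix B.9.2] [cite: Kleiman1974Transversality, Thm. 2 (i)] -/
theorem isOpen_dense_ae_setOf_inter_vadd_eq_empty {Y₁ Y₂ : Set (ComplexTorus Φ)} {d₁ d₂ : ℕ}
    (hY₁ : HasPureDim 𝓘(ℂ, E) Y₁ d₁) (hY₂ : HasPureDim 𝓘(ℂ, E) Y₂ d₂) (hlt : d₁ + d₂ < finrank ℂ E) :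
    IsOpen {t : ComplexTorus Φ | Y₁ ∩ (t +ᵥ Y₂) = ∅} ∧ Dense {t : ComplexTorus Φ | Y₁ ∩ (t +ᵥ Y₂) = ∅} ∧
      ∀ᵐ t ∂(volume : Measure (ComplexTorus Φ)), Y₁ ∩ (t +ᵥ Y₂) = ∅ :=
  have hae := ae_inter_vadd_eq_empty Φ hY₁ hY₂ hlt
  ⟨isOpen_setOf_inter_vadd_eq_empty Φ hY₁.isAnalyticSet.isClosed hY₂.isAnalyticSet.isClosed,
    Measure.dense_of_ae hae, hae⟩

/-- **`Y₁ − Y₂ ≠ X`**: some translate of `Y₂` misses `Y₁`. [cite: Fulton1998, Example 11.4.5 and Appendix B.9.2] -/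
theorem sub_ne_univ {Y₁ Y₂ : Set (ComplexTorus Φ)} {d₁ d₂ : ℕ} (hY₁ : HasPureDim 𝓘(ℂ, E) Y₁ d₁)
    (hY₂ : HasPureDim 𝓘(ℂ, E) Y₂ d₂) (hlt : d₁ + d₂ < finrank ℂ E) : Y₁ - Y₂ ≠ univ := by
  obtain ⟨t, ht⟩ := (ae_inter_vadd_eq_empty Φ hY₁ hY₂ hlt).exists
  rw [Ne, eq_univ_iff_forall]
  intro h
  have h' := (mem_sub_iff_inter_vadd_nonempty' Φ Y₁ Y₂ t).1 (h t)
  exact h'.ne_empty ht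

/-- **`Y₁ − Y₂` has empty interior** (a compact Haar-null set).
[cite: Fulton1998, Example 11.4.5 and Appendix B.9.2] -/
theorem interior_sub_eq_empty {Y₁ Y₂ : Set (ComplexTorus Φ)} {d₁ d₂ : ℕ} (hY₁ : HasPureDim 𝓘(ℂ, E) Y₁ d₁)
    (hY₂ : HasPureDim 𝓘(ℂ, E) Y₂ d₂) (hlt : d₁ + d₂ < finrank ℂ E) : interior (Y₁ - Y₂) = ∅ := by
  rw [interior_eq_empty_iff_dense_compl, compl_sub_eq_setOf_inter_vadd_eq_empty]
  exact (isOpen_dense_ae_setOf_inter_vadd_eq_empty Φ hY₁ hY₂ hlt).2.1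

/-- `(· + t)⁻¹'` spelling: **Haar-almost every `Y₁ ∩ (Y₂ − t)` is empty** when `dim Y₁ + dim Y₂ < g`.
[cite: Fulton1998, Example 11.4.5 and Appendix B.9.2] [cite: Kleiman1974Transversality, Thm. 2 (i)] -/
theorem ae_inter_preimage_add_eq_empty {Y₁ Y₂ : Set (ComplexTorus Φ)} {d₁ d₂ : ℕ}
    (hY₁ : HasPureDim 𝓘(ℂ, E) Y₁ d₁) (hY₂ : HasPureDim 𝓘(ℂ, E) Y₂ d₂) (hlt : d₁ + d₂ < finrank ℂ E) :
    ∀ᵐ t ∂(volume : Measure (ComplexTorus Φ)), Y₁ ∩ (fun x ↦ x + t) ⁻¹' Y₂ = ∅ := by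
  have hpre : ∀ s : ComplexTorus Φ, (fun x ↦ x + s) ⁻¹' Y₂ = -s +ᵥ Y₂ := by
    intro s
    ext x
    rw [mem_preimage, Set.mem_vadd_set_iff_neg_vadd_mem, neg_neg, vadd_eq_add, add_comm]
  have hneg : ∀ᵐ t ∂(volume : Measure (ComplexTorus Φ)), Y₁ ∩ ((- -t : ComplexTorus Φ) +ᵥ Y₂) = ∅ := by
    filter_upwards [ae_inter_vadd_eq_empty Φ hY₁ hY₂ hlt] with t ht
    rwa [neg_neg]
  rw [ae_iff] at hneg ⊢
  rw [← Measure.measure_preimage_neg (volume : Measure (ComplexTorus Φ))] at hneg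
  simpa only [hpre, preimage_setOf_eq, neg_neg] using hneg

/-- **A general translate of `Y` avoids a given point**: for `Y ⊆ X` of pure dimension `d < g` and
`y ∈ X`, Haar-almost every translate `t + Y` does not contain `y`. [cite: Fulton1998, Appendix B.9.2] -/
theorem ae_notMem_vadd {Y : Set (ComplexTorus Φ)} {d : ℕ} (hY : HasPureDim 𝓘(ℂ, E) Y d) (hd : d < finrank ℂ E)
    (y : ComplexTorus Φ) : ∀ᵐ t ∂(volume : Measure (ComplexTorus Φ)), y ∉ t +ᵥ Y := by
  filter_upwards [ae_inter_vadd_eq_empty Φ (hasPureDim_singleton (E₀ := E) y) hY (by simpa using hd)]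
    with t ht
  exact fun h ↦ (eq_empty_iff_forall_notMem.1 ht) y ⟨mem_singleton y, h⟩

/-- **A general translate of `Y` avoids a given finite set.** [cite: Fulton1998, Appendix B.9.2] -/
theorem ae_disjoint_vadd_of_finite {Y : Set (ComplexTorus Φ)} {d : ℕ} (hY : HasPureDim 𝓘(ℂ, E) Y d)
    (hd : d < finrank ℂ E) {S : Set (ComplexTorus Φ)} (hS : S.Finite) :
    ∀ᵐ t ∂(volume : Measure (ComplexTorus Φ)), Disjoint S (t +ᵥ Y) := by
  have h : ∀ᵐ t ∂(volume : Measure (ComplexTorus Φ)), ∀ y ∈ S, y ∉ t +ᵥ Y :=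
    (ae_ball_iff hS.countable).2 fun y _ ↦ ae_notMem_vadd Φ hY hd y
  filter_upwards [h] with t ht
  exact Set.disjoint_left.2 fun y hy ↦ ht y hy

end ComplexTorus

end Literature.Geometry.Kaehler
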